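import Summits.BirchSwinnertonDyer.BirchSwinnertonDyer.Theorems.ThetaPartnerAtTwoSignedControlAtTwoKleinFourVanishing
import Summits.BirchSwinnertonDyer.BirchSwinnertonDyer.Theorems.ThetaPartnerAtTwoSignedControlAtTwoArchMovesKernelCdTwo
import Literature.NumberTheory.EllipticCurves.KummerSelmerStructure
import Literature.NumberTheory.EllipticCurves.GeomPointsGaloisModule
import Literature.NumberTheory.GaloisCohomology.ArchimedeanInvariantMap
import Literature.NumberTheory.GaloisRepresentations.ContinuousH1OrderTwo
import HarnessLib

/-!
# `H³(ℚ, E[2]) = 0` and `H²(ℚ_∞, E[2]) = 0` when complex conjugation moves `E[2]`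
# (K4 `SignedControlAtTwo`, archimedean rows at the consumed module `E[2]`, file 3/3)

Crux K4 `SignedControlAtTwo` (stmt-BirchSwinnertonDyer-20309; routes `ThetaPartnerAtTwo` / `ResidualThetaTransportAtTwo`),
line `eulerchar` v12; width seat `bsd-wall-tp2-p3-w3` g8 (`--supports stmt-BirchSwinnertonDyer-20309`, helper).

The two archimedean Poitou–Tate rows registered as stubs of the line — `stub_poitouTateThreeRealRat`
(Milne *ADT* I 4.10 (c): `H³(ℚ, M) ↪ H³(ℝ, M)`) and `stub_poitouTateTwoRealRat` (Cor. 4.16: `H²(ℚ, M) ↠ H²(ℝ, M)`) —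
are consumed (`SignedEC.ShaTwo.exists_nsmul_eq_of_mem_shaTwo`) ONLY at the module `M = E[2]`.  For an elliptic curve
`E/ℚ` with `E(ℚ)[2] = 0` (e.g. good supersingular at `2`) on which THE COMPLEX CONJUGATION MOVES `E[2]`
(⟺ `Δ(E) < 0` ⟺ `E(ℝ)[2] ≅ ℤ/2`; stated here as «some element of `Γ_{ℚ_∞}` moves a `2`-torsion point») both
instances are THEOREMS:

* §1 `subsingleton_continuousCohomology_two_of_invariants` — for a group `G = {1, c}` of order `≤ 2` and any
  topological `G`-module `X` with `X^c ⊆ (1 + c) X`, `H²(G, X) = 0` (cochain level: a `2`-cocycle `f` with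
  `f(c, c) + f(1, 1) = y + c y` is the coboundary of `b(1) = f(1, 1)`, `b(c) = y`; Serre, *Corps locaux* VIII §4);
* §2 `exists_isKleinFour_of_sq_eq_one` — an involution `τ ∈ Γ_ℚ` moving `E[2]` swaps two points `P₁, P₂` and
  `E[2] = {0, P₁, P₂, P₁ + P₂}` (`#E[2] = 4`, Silverman III.6.4 (b), tree theorem `natCard_geomTorsion`);
* §3 **`subsingleton_galoisCohomology_three_twoTorsion`** — `H³(ℚ, E[2]) = 0` if `E(ℚ)[2] = 0` and an involution of
  `Γ_ℚ` moves `E[2]`: `SignedEC.KleinFour.subsingleton_H_three_of_kleinFour` (Shapiro + `(Γ_ℚ : Stab) = 3` + `2 H³ = 0`)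
  with `cd₂(Gal(ℚ̄/ℚ(E[2]))) ≤ 2` from `SignedEC.ArchMoves.groupCdLE_two_ker_of_involution_moves` (`ℚ(E[2])` is totally
  complex; Serre II §4.4 Prop. 13 = tree theorem `fieldCdLE_two_of_numberField_holds`);
* §4 at the real place `w` of `ℚ`: **`subsingleton_galoisCohomology_three_twoTorsion_of_moves`** and
  **`subsingleton_galoisCohomology_two_toLocal_twoTorsion_of_moves`** (`H²(Γ_{ℚ_w}, E[2]) = 0`), and the two facts in
  the EXACT binder shape in which `exists_nsmul_eq_of_mem_shaTwo` consumes the stubs: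
  `threeRealPlaces_twoTorsion_of_moves`, `twoRealPlaces_twoTorsion_of_moves`.

HONEST FRAMING: THEOREMS only (no definition, no named fact, no `sorry`); the sub-row condition «`Γ_{ℚ_∞}` moves `E[2]`»
is an explicit hypothesis; on the complementary sub-row (`Δ > 0`, `ℚ(E[2])` totally real) the stubs stay cited; closes
no item; BSD is not proved by any of this.

References: [MilneADT2006] I Thm. 4.10 (c), Cor. 4.16, Thm. 2.13; [SerreGaloisCohomology1997] I §2.4–2.5, II §4.4 Prop. 13;
[SerreLocalFields1979] VIII §4; [SilvermanAEC2009] III.6.4 (b).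
-/

set_option autoImplicit false
-- the Theorems namespace of this sub repeats the summit name by design (D-0017 nested layout)
set_option linter.dupNamespace false

noncomputable section

open CategoryTheory

namespace Summit.BirchSwinnertonDyer.BirchSwinnertonDyer.Theorems.SignedEC.ArchMoves

open _root_.TopRep _root_.ContinuousCohomology
open Field NumberField WeierstrassCurve Literature.NumberTheory.GaloisRepresentations
open Literature.NumberTheory.EllipticCurves Literature.NumberTheory.GaloisCohomology
open Summit.BirchSwinnertonDyer.BirchSwinnertonDyer.Theorems.SignedEC.KleinFour

/-! ## §1 `H²({1, c}, X) = 0` when `X^c ⊆ (1 + c) X` -/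

section OrderTwo

universe v

variable {R : Type} [CommRing R] [TopologicalSpace R]
variable {G : Type v} [Group G] [TopologicalSpace G] [IsTopologicalGroup G]

/-- **A `2`-cocycle of a group `{1, c}` of order `≤ 2` is a coboundary as soon as its (invariant) diagonal
`f(c, c) + f(1, 1)` is a norm `y + c y`**: `f = ∂b` with `b(1) = f(1, 1)`, `b(c) = y` (`f(1, τ) = f(1, 1)`,
`f(σ, 1) = σ f(1, 1)`, and `(1 + c) b(c) = f(c, c) + f(1, 1)` at `(c, c)`).  Serre, *Corps locaux* VIII §4
(`H²(G, A) = A^G / N_G A` for `G` cyclic of order `2`). [cite: SerreLocalFields1979, VIII §4] -/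
theorem twoCocycleClass_eq_zero_of_diagonal_eq_norm [Finite G] [DiscreteTopology G] (hG : Nat.card G ≤ 2)
    {c : G} (hc : c ≠ 1) (X : TopRep.{v} R G) (f : contTwoCocycles X) (y : X)
    (hy : f.1 (c, c) + f.1 (1, 1) = y + X.ρ c y) : twoCocycleClass X f = 0 := by
  classical
  rw [twoCocycleClass_eq_zero_iff]
  refine ⟨⟨fun σ => if σ = 1 then f.1 (1, 1) else y, continuous_of_discreteTopology⟩, fun σ τ => ?_⟩
  simp only [ContinuousMap.coe_mk]
  have h1 : X.ρ (1 : G) = 1 := map_one X.ρ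
  rcases eq_or_ne σ 1 with rfl | hσ
  · rw [contTwoCocycles.apply_one_left, h1, one_mul, if_pos rfl]
    change f.1 (1, 1) = (if τ = 1 then f.1 (1, 1) else y) - (if τ = 1 then f.1 (1, 1) else y) + f.1 (1, 1)
    rw [sub_self, zero_add]
  · obtain rfl : σ = c := eq_of_ne_one_of_natCard_le_two hG hσ hc
    rcases eq_or_ne τ 1 with rfl | hτ
    · rw [contTwoCocycles.apply_one_right, mul_one, if_pos rfl, if_neg hσ, sub_add_cancel]
    · obtain rfl : τ = σ := eq_of_ne_one_of_natCard_le_two hG hτ hσ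
      rw [mul_self_eq_one_of_natCard_le_two hG τ, if_neg hτ, if_pos rfl, eq_sub_of_add_eq hy]
      abel

/-- **`H²({1, c}, X) = 0` when every `c`-invariant of `X` is a norm `y + c y`** (group of order `≤ 2` with a
non-trivial element `c`, any topological coefficients; the diagonal `f(c, c) + f(1, 1)` of a `2`-cocycle is
`c`-invariant by the cocycle identity at `(c, c, c)`). [cite: SerreLocalFields1979, VIII §4] -/
theorem subsingleton_continuousCohomology_two_of_invariants [Finite G] [DiscreteTopology G]
    [LocallyCompactSpace G] (hG : Nat.card G ≤ 2) {c : G} (hc : c ≠ 1) (X : TopRep.{v} R G)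
    (hX : ∀ x : X, X.ρ c x = x → ∃ y : X, x = y + X.ρ c y) :
    Subsingleton (continuousCohomology 2 X) := by
  refine subsingleton_of_forall_eq 0 fun z => ?_
  obtain ⟨f, rfl⟩ := twoCocycleClass_surjective X z
  -- the diagonal is `c`-invariant: cocycle identity at `(c, c, c)`
  have hcc : c * c = 1 := mul_self_eq_one_of_natCard_le_two hG c
  have hinv : X.ρ c (f.1 (c, c) + f.1 (1, 1)) = f.1 (c, c) + f.1 (1, 1) := by
    have h := f.2 c c c
    rw [hcc, contTwoCocycles.apply_one_left, contTwoCocycles.apply_one_right] at h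
    rw [map_add, h, add_comm]
  obtain ⟨y, hy⟩ := hX _ hinv
  exact twoCocycleClass_eq_zero_of_diagonal_eq_norm hG hc X f y hy

end OrderTwo

/-! ## §2 `E[2]` as a Klein four-group swapped by an involution -/

section TwoTorsion

variable (W : WeierstrassCurve ℚ) [W.IsElliptic]

omit [W.IsElliptic] in
/-- `2 P = 0` on `E[2]`. [folklore] -/
theorem two_nsmul_twoTorsion (P : W.geomTorsion ((2 : ℕ) : ℤ)) : 2 • P = 0 := by
  apply Subtype.ext
  have h : (((2 : ℕ) : ℤ)) • (P : W.geomPoints) = 0 := P.2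
  rwa [natCast_zsmul] at h

/-- `#E[2] = 4` at the level `((2 : ℕ) : ℤ)` (Silverman III.6.4 (b), tree theorem `natCard_geomTorsion`).
[cite: SilvermanAEC2009, Cor. III.6.4(b)] -/
theorem natCard_twoTorsion : Nat.card (W.geomTorsion ((2 : ℕ) : ℤ)) = 4 := by
  rw [W.natCard_geomTorsion ((2 : ℕ) : ℤ) (by norm_num)]
  rfl

/-- **An involution of `Γ_ℚ` moving `E[2]` swaps two points `P₁, P₂`, and `E[2] = {0, P₁, P₂, P₁ + P₂}` is a Klein
four-group** (`P₁ := Q` a moved point, `P₂ := τ Q`; the four listed points are distinct and `#E[2] = 4`).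
[cite: SilvermanAEC2009, Cor. III.6.4(b)] -/
theorem exists_isKleinFour_of_sq_eq_one {τ : absoluteGaloisGroup ℚ} (hτ2 : τ ^ 2 = 1)
    {Q : W.geomTorsion ((2 : ℕ) : ℤ)} (hQ : W.torsionGaloisModule ((2 : ℕ) : ℤ) τ Q ≠ Q) :
    ∃ P₁ P₂ : W.geomTorsion ((2 : ℕ) : ℤ), IsKleinFour (W.geomTorsion ((2 : ℕ) : ℤ)) P₁ P₂ ∧
      W.torsionGaloisModule ((2 : ℕ) : ℤ) τ P₁ = P₂ ∧ W.torsionGaloisModule ((2 : ℕ) : ℤ) τ P₂ = P₁ := by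
  set ρ := W.torsionGaloisModule ((2 : ℕ) : ℤ) with hρ
  have hττ : ∀ m, ρ τ (ρ τ m) = m := fun m => by
    rw [← Module.End.mul_apply, ← map_mul, ← pow_two, hτ2, map_one, Module.End.one_apply]
  have h2 : ∀ m : W.geomTorsion ((2 : ℕ) : ℤ), 2 • m = 0 := two_nsmul_twoTorsion W
  have hself : ∀ m : W.geomTorsion ((2 : ℕ) : ℤ), m + m = 0 := fun m => by rw [← two_nsmul]; exact h2 m
  -- `P₁ = Q`, `P₂ = τ Q`
  have hQ0 : Q ≠ 0 := by
    rintro rfl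
    exact hQ (map_zero _)
  have hτQ0 : ρ τ Q ≠ 0 := fun h => hQ0 (by simpa [h] using (hττ Q).symm)
  have hne : Q ≠ ρ τ Q := fun h => hQ h.symm
  have hs0 : Q + ρ τ Q ≠ 0 := fun h => by
    apply hne
    have := congrArg (· + ρ τ Q) h
    simp only [add_assoc, hself, add_zero, zero_add] at this
    exact this
  have hs1 : Q + ρ τ Q ≠ Q := fun h => hτQ0 (by simpa using h)
  have hs2 : Q + ρ τ Q ≠ ρ τ Q := fun h => hQ0 (by simpa using h)
  -- the four points exhaust `E[2]`
  haveI : Finite (W.geomTorsion ((2 : ℕ) : ℤ)) := Nat.finite_of_card_ne_zero (by rw [natCard_twoTorsion]; norm_num)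
  letI : Fintype (W.geomTorsion ((2 : ℕ) : ℤ)) := Fintype.ofFinite _
  have hall : ∀ m : W.geomTorsion ((2 : ℕ) : ℤ), m = 0 ∨ m = Q ∨ m = ρ τ Q ∨ m = Q + ρ τ Q := by
    classical
    have hcard : ({0, Q, ρ τ Q, Q + ρ τ Q} : Finset (W.geomTorsion ((2 : ℕ) : ℤ))).card =
        Fintype.card (W.geomTorsion ((2 : ℕ) : ℤ)) := by
      rw [Fintype.card_eq_nat_card, natCard_twoTorsion, Finset.card_insert_of_notMem,
        Finset.card_insert_of_notMem, Finset.card_insert_of_notMem, Finset.card_singleton]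
      · simp only [Finset.mem_singleton]
        exact hs2.symm
      · simp only [Finset.mem_insert, Finset.mem_singleton, not_or]
        exact ⟨hne, hs1.symm⟩
      · simp only [Finset.mem_insert, Finset.mem_singleton, not_or]
        exact ⟨hQ0.symm, hτQ0.symm, hs0.symm⟩
    have huniv := Finset.eq_univ_of_card _ hcard
    intro m
    have hm : m ∈ ({0, Q, ρ τ Q, Q + ρ τ Q} : Finset _) := by rw [huniv]; exact Finset.mem_univ m
    simpa only [Finset.mem_insert, Finset.mem_singleton] using hm
  exact ⟨Q, ρ τ Q, ⟨hall, h2, hQ0, hτQ0, hne⟩, rfl, hττ Q⟩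

/-! ## §3 `H³(ℚ, E[2]) = 0` -/

/-- **`H³(ℚ, E[2]) = 0` when `E(ℚ)[2] = 0` and an involution of `Γ_ℚ` moves `E[2]`** — the instance of Milne *ADT*
I Thm. 4.10 (c) at `M = E[2]` consumed by the K4 line, on the sub-row «complex conjugation moves `E[2]`» (⟺ `Δ < 0`):
`SignedEC.KleinFour.subsingleton_H_three_of_kleinFour` with `cd₂(Gal(ℚ̄/ℚ(E[2]))) ≤ 2`
(`SignedEC.ArchMoves.groupCdLE_two_ker_of_involution_moves`).
[cite: MilneADT2006, Ch. I, Thm. 4.10 (c)] [cite: SerreGaloisCohomology1997, II §4.4 Prop. 13] -/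
theorem subsingleton_galoisCohomology_three_twoTorsion
    (h0 : ∀ Q : W.geomTorsion ((2 : ℕ) : ℤ), Q ≠ 0 →
      ∃ g : absoluteGaloisGroup ℚ, W.torsionGaloisModule ((2 : ℕ) : ℤ) g Q ≠ Q)
    {τ : absoluteGaloisGroup ℚ} (hτ2 : τ ^ 2 = 1) {Q : W.geomTorsion ((2 : ℕ) : ℤ)}
    (hQ : W.torsionGaloisModule ((2 : ℕ) : ℤ) τ Q ≠ Q) :
    Subsingleton (galoisCohomology (W.torsionGaloisModule ((2 : ℕ) : ℤ)) 3) := by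
  haveI : Finite (W.geomTorsion ((2 : ℕ) : ℤ)) := Nat.finite_of_card_ne_zero (by rw [natCard_twoTorsion]; norm_num)
  obtain ⟨P₁, P₂, hK, hτ₁, hτ₂⟩ := exists_isKleinFour_of_sq_eq_one W hτ2 hQ
  exact subsingleton_H_three_of_kleinFour (W.torsionGaloisModule ((2 : ℕ) : ℤ)) hK h0 hτ₁ hτ₂
    (groupCdLE_two_ker_of_involution_moves (W.torsionGaloisModule ((2 : ℕ) : ℤ)) hτ2 ⟨Q, hQ⟩)

end TwoTorsion

/-! ## §4 At the real place: both archimedean rows at `E[2]` -/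

section RealPlace

variable (W : WeierstrassCurve ℚ) [W.IsElliptic]

/-- **`H³(ℚ, E[2]) = 0` when `E(ℚ)[2] = 0` and the archimedean decomposition group `Γ_{ℚ_w}` moves `E[2]`** (its
non-trivial element restricts to an involution of `Γ_ℚ`). [cite: MilneADT2006, Ch. I, Thm. 4.10 (c)] -/
theorem subsingleton_galoisCohomology_three_twoTorsion_of_moves
    (h0 : ∀ Q : W.geomTorsion ((2 : ℕ) : ℤ), Q ≠ 0 →
      ∃ g : absoluteGaloisGroup ℚ, W.torsionGaloisModule ((2 : ℕ) : ℤ) g Q ≠ Q)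
    (w : InfinitePlace ℚ)
    (hmove : ∃ (σ : absoluteGaloisGroup (Place.Completion (Sum.inl w : Place ℚ))) (Q : W.geomTorsion ((2 : ℕ) : ℤ)),
      (W.torsionGaloisModule ((2 : ℕ) : ℤ)).toLocal (Sum.inl w) σ Q ≠ Q) :
    Subsingleton (galoisCohomology (W.torsionGaloisModule ((2 : ℕ) : ℤ)) 3) := by
  obtain ⟨σ, Q, hQ⟩ := hmove
  haveI := finite_absoluteGaloisGroup_placeCompletion_inl ℚ w
  have hσ2 : σ ^ 2 = 1 := by
    rw [pow_two]
    exact mul_self_eq_one_of_natCard_le_two (natCard_absoluteGaloisGroup_placeCompletion_inl_le_two ℚ w) σ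
  rw [DiscreteGaloisModule.toLocal_apply] at hQ
  refine subsingleton_galoisCohomology_three_twoTorsion W h0 (τ := absGaloisRestrict ℚ _ σ) ?_ hQ
  rw [← map_pow, hσ2, map_one]

/-- **`H²(Γ_{ℚ_w}, E[2]) = 0` when `Γ_{ℚ_w}` moves `E[2]`**: its non-trivial element `c` acts as the transposition
`P₁ ↔ P₂`, so `E[2]^c = {0, P₁ + P₂} = (1 + c) E[2]` and §1 applies (Milne I Thm. 2.13 / Serre VIII §4:
`H²(Gal(ℂ/ℝ), M) = M^c/N M`). [cite: MilneADT2006, Ch. I, Thm. 2.13] [cite: SerreLocalFields1979, VIII §4] -/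
theorem subsingleton_galoisCohomology_two_toLocal_twoTorsion_of_moves (w : InfinitePlace ℚ)
    (hmove : ∃ (σ : absoluteGaloisGroup (Place.Completion (Sum.inl w : Place ℚ))) (Q : W.geomTorsion ((2 : ℕ) : ℤ)),
      (W.torsionGaloisModule ((2 : ℕ) : ℤ)).toLocal (Sum.inl w) σ Q ≠ Q) :
    Subsingleton (galoisCohomology ((W.torsionGaloisModule ((2 : ℕ) : ℤ)).toLocal (Sum.inl w)) 2) := by
  obtain ⟨σ, Q, hQ⟩ := hmove
  haveI := finite_absoluteGaloisGroup_placeCompletion_inl ℚ w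
  have hG := natCard_absoluteGaloisGroup_placeCompletion_inl_le_two ℚ w
  have hσ2 : σ ^ 2 = 1 := by
    rw [pow_two]
    exact mul_self_eq_one_of_natCard_le_two hG σ
  have hσ1 : σ ≠ 1 := by
    rintro rfl
    exact hQ (by rw [map_one, Module.End.one_apply])
  have hQ' := hQ
  rw [DiscreteGaloisModule.toLocal_apply] at hQ'
  have hτ2 : absGaloisRestrict ℚ _ σ ^ 2 = 1 := by rw [← map_pow, hσ2, map_one]
  obtain ⟨P₁, P₂, hK, hτ₁, hτ₂⟩ := exists_isKleinFour_of_sq_eq_one W hτ2 hQ'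
  refine subsingleton_continuousCohomology_two_of_invariants hG hσ1
    ((W.torsionGaloisModule ((2 : ℕ) : ℤ)).toLocal (Sum.inl w)).toTopRep fun x hx => ?_
  change (W.torsionGaloisModule ((2 : ℕ) : ℤ)).toLocal (Sum.inl w) σ x = x at hx
  rw [DiscreteGaloisModule.toLocal_apply] at hx
  rcases hK.eq_or x with rfl | rfl | rfl | rfl
  · exact ⟨0, by rw [map_zero, add_zero]⟩
  · exact absurd (hx.symm.trans hτ₁) hK.ne₁₂
  · exact absurd (hx.symm.trans hτ₂) hK.ne₁₂.symm
  · refine ⟨P₁, ?_⟩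
    change P₁ + P₂ = P₁ + (W.torsionGaloisModule ((2 : ℕ) : ℤ)).toLocal (Sum.inl w) σ P₁
    rw [DiscreteGaloisModule.toLocal_apply, hτ₁]

/-- **Milne I Thm. 4.10 (c) at `M = E[2]`, in the binder shape consumed by `SignedEC.ShaTwo.exists_nsmul_eq_of_mem_shaTwo`**:
a class of `H³(ℚ, E[2])` dying at the infinite places is `0` — here because `H³(ℚ, E[2]) = 0` outright.
[cite: MilneADT2006, Ch. I, Thm. 4.10 (c)] -/
theorem threeRealPlaces_twoTorsion_of_moves
    (h0 : ∀ Q : W.geomTorsion ((2 : ℕ) : ℤ), Q ≠ 0 →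
      ∃ g : absoluteGaloisGroup ℚ, W.torsionGaloisModule ((2 : ℕ) : ℤ) g Q ≠ Q)
    (w₀ : InfinitePlace ℚ)
    (hmove : ∃ (σ : absoluteGaloisGroup (Place.Completion (Sum.inl w₀ : Place ℚ))) (Q : W.geomTorsion ((2 : ℕ) : ℤ)),
      (W.torsionGaloisModule ((2 : ℕ) : ℤ)).toLocal (Sum.inl w₀) σ Q ≠ Q)
    (c : galoisCohomology (W.torsionGaloisModule ((2 : ℕ) : ℤ)) 3)
    (_hc : ∀ w : InfinitePlace ℚ,
      galoisCohomology.localization (W.torsionGaloisModule ((2 : ℕ) : ℤ)) (Sum.inl w) 3 c = 0) : c = 0 := by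
  haveI := subsingleton_galoisCohomology_three_twoTorsion_of_moves W h0 w₀ hmove
  exact Subsingleton.elim _ _

/-- **Milne I Cor. 4.16 at `M = E[2]` over `ℚ`, in the binder shape consumed by `SignedEC.ShaTwo.exists_nsmul_eq_of_mem_shaTwo`**:
every family of local classes `r_w ∈ H²(ℚ_w, E[2])` at the infinite places is realised by a global class at the real places —
here trivially by `0`, since `H²(ℚ_w, E[2]) = 0` (`ℚ` has one infinite place). [cite: MilneADT2006, Ch. I, Cor. 4.16] -/
theorem twoRealPlaces_twoTorsion_of_moves (w₀ : InfinitePlace ℚ)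
    (hmove : ∃ (σ : absoluteGaloisGroup (Place.Completion (Sum.inl w₀ : Place ℚ))) (Q : W.geomTorsion ((2 : ℕ) : ℤ)),
      (W.torsionGaloisModule ((2 : ℕ) : ℤ)).toLocal (Sum.inl w₀) σ Q ≠ Q)
    (r : ∀ w : InfinitePlace ℚ, galoisCohomology ((W.torsionGaloisModule ((2 : ℕ) : ℤ)).toLocal (Sum.inl w)) 2) :
    ∃ c : galoisCohomology (W.torsionGaloisModule ((2 : ℕ) : ℤ)) 2,
      ∀ w : InfinitePlace ℚ, w.IsReal →
        galoisCohomology.localization (W.torsionGaloisModule ((2 : ℕ) : ℤ)) (Sum.inl w) 2 c = r w := by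
  refine ⟨0, fun w _ => ?_⟩
  obtain rfl : w = w₀ := Subsingleton.elim _ _
  haveI := subsingleton_galoisCohomology_two_toLocal_twoTorsion_of_moves W w hmove
  rw [map_zero]
  exact Subsingleton.elim _ _

end RealPlace

end Summit.BirchSwinnertonDyer.BirchSwinnertonDyer.Theorems.SignedEC.ArchMoves

end
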